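import Literature.NumberTheory.Automorphic.FLSModularityLiftingTheorem
import Literature.NumberTheory.Automorphic.CDTTheorem722SerreLevelProofs
import Literature.NumberTheory.EllipticCurves.IsogenyFrobeniusTraceHoldsProofs
import Literature.NumberTheory.GaloisRepresentations.CyclotomicDeterminantImageProofs
import Literature.NumberTheory.EllipticCurves.SkinnerUrban2014.SemistableCurvesProofs
import Literature.NumberTheory.EllipticCurves.NonvanishingTwistsWaldspurgerOfHoffsteinLuo
import Literature.NumberTheory.EllipticCurves.GlobalMinimalModelProofs
import Literature.NumberTheory.EllipticCurves.MatarNekovar2019.IrreducibleOverQuadraticFieldClauseThreeProofs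
import Literature.NumberTheory.EllipticCurves.LFunctionSmulProofs
import HarnessLib

/-!
# Stub-ideation k = 2, GENERATION 2 (family RESHAPE) for `stub_liftFive` of crux `FreyModularity`
# (stmt-ABC-11340, route ABC/DefiniteXi, line `Lines/Sketch.lean`)

Helper-lemma SIGNATURES (`sorry` bodies, each a registered-stub candidate) + KERNEL-CHECKED glue:
* Plan A (transplant to the totally-real carrier at `K = ℚ`, `FLS2015_theorem2`): the dictionary is
  cut into A1 (`√5 → ζ₅`, Clifford on `2 × 2` matrices), D1 (integral model, PROVED here), D2′
  (residual Hilbert-modularity of a modular curve's `E[5]`), D4a (weight-zero `π` ↦ newform on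
  `Γ₀`), with D4 = D4a + Serre §4.6 (tree, granted ES + Carayol) PROVED here;
* Plan B (bootstrap through Serre's conjecture): the tree's KW road with its weight hypothesis
  DISCHARGED at the canonical local datum (B2, PROVED here) and the road re-threaded at that datum
  (B1′, mechanical);
* the registered stub `Sig` verbatim and the closers `stub_liftFive_of_planA`, `stub_liftFive_of_KW`.
-/

set_option linter.dupNamespace false

noncomputable section

open scoped NumberField Polynomial MatrixGroups
open NumberField Polynomial IsDedekindDomain
open Literature.NumberTheory.GaloisRepresentations
open Literature.NumberTheory.Automorphic
open Literature.NumberTheory.Automorphic.BCDT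
open Literature.NumberTheory.EllipticCurves Literature.NumberTheory.EllipticCurves.ModularForms
open WeierstrassCurve

namespace Summit.ABC.ABC.Cruxes.FreyModularity.StubIdeas.LiftFive2g2

/-- The registered stub `stub_liftFive`, verbatim. -/
def Sig : Prop :=
  ∀ (W : WeierstrassCurve ℚ) [W.IsElliptic] (ρ : ModPGaloisRep ℚ (ZMod 5) 2),
    W.IsTorsionGaloisRep 5 ρ → ρ.IsAbsIrreducibleOverSqrt 5 → ¬ 25 ∣ W.conductorNorm ℤ →
    ρ.IsModular → W.IsModularGaloisRepTate 5

/-! ## Plan A — `FLS2015_theorem2` at `K = ℚ`, `p = 5`; the dictionary, cut into one-cycle lemmas -/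

/-- **A1-mat (Clifford for plane groups; M, pure linear algebra — the content of `√5 → ζ₅`).**
`G ≤ GL₂(𝔽₅)` with an element of determinant `2` (a generator of `𝔽₅ˣ`: `det G = 𝔽₅ˣ`).  If the
determinant-one part `G¹` has a common eigenvector after some base change `f : 𝔽₅ → B`, then the
determinant-`±1` part `G²` has one after a further base change.  Proof: `G¹ ⊴ G`, `G/G¹ ↪ 𝔽₅ˣ`
cyclic; if `G¹` is scalar then `G² = G¹ ∪ hG¹` is abelian; else `G¹` has `≤ 2` common eigenlines,
`G` permutes them, the stabiliser has index `≤ 2` and contains `G¹`, hence contains the unique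
index-`2` overgroup `G²` (it is not `G`: a `G`-stable line would make `G²` reducible too).
Certified numerically for all 48 subgroup classes (k = 3, kit job j344379; fails without `hdet`). -/
theorem exists_eigenvector_detSq_of_eigenvector_detOne {B : Type} [Field B] (f : ZMod 5 →+* B)
    (G : Subgroup (GL (Fin 2) (ZMod 5)))
    (hdet : ∃ g ∈ G, Matrix.GeneralLinearGroup.det g = ⟨2, 3, by decide, by decide⟩)
    (v : Fin 2 → B) (hv : v ≠ 0)
    (h1 : ∀ g ∈ G, Matrix.GeneralLinearGroup.det g = 1 →
      ∃ a : B, Matrix.mulVec ((g : Matrix (Fin 2) (Fin 2) (ZMod 5)).map f) v = a • v) :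
    ∃ (B' : Type) (_ : Field B') (f' : ZMod 5 →+* B') (w : Fin 2 → B'), w ≠ 0 ∧
      ∀ g ∈ G, (Matrix.GeneralLinearGroup.det g = 1 ∨ Matrix.GeneralLinearGroup.det g = -1) →
        ∃ a : B', Matrix.mulVec ((g : Matrix (Fin 2) (Fin 2) (ZMod 5)).map f') w = a • w := by
  sorry

/-- **A1 (Galois form; S given A1-mat + the tree's vector API).** For `ρ̄ : Γ_ℚ → GL₂(𝔽₅)` with
`det ρ̄ = χ̄₅`: absolutely irreducible over `ℚ(√5)` ⇒ absolutely irreducible over `ℚ(ζ₅)`.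
Contrapositive: `exists_eigenvector_of_det_eq_one_of_not_isAbsolutelyIrreducible_restrictField`
(eigenvector of `G¹ = ρ̄(Γ_{ℚ(ζ₅)})`, FLS Prop. 3.1 (i)), A1-mat with `det G = 𝔽₅ˣ`
(`modPCyclotomicCharacterZMod_rat_surjective`), and `ρ̄(Γ_{ℚ(√5)}) ⊆ G²` (`χ̄₅|Γ_{ℚ(√5)} = ±1`:
`det_eq_one_or_eq_neg_one_of_isTorsionGaloisRep_of_isSquare_five` after
`IsTorsionGaloisRep.restrictField`, or `sq_mem_range_absGaloisRestrict`). -/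
theorem isAbsolutelyIrreducible_restrictField_cyclotomic_of_isAbsIrreducibleOverSqrt_five
    (ρ : ModPGaloisRep ℚ (ZMod 5) 2)
    (hdet : ∀ σ : Field.absoluteGaloisGroup ℚ,
      Matrix.GeneralLinearGroup.det (ρ σ) = modPCyclotomicCharacterZMod ℚ 5 σ)
    (h : ρ.IsAbsIrreducibleOverSqrt 5)
    (L : Type) [Field L] [Algebra ℚ L] [IsCyclotomicExtension {5} ℚ L] :
    FramedRep.IsAbsolutelyIrreducible (FramedGaloisRep.restrictField L ρ) := by
  sorry

/-- **A1 (curve form = hypothesis (ii) of FLS Thm. 2 at `K = ℚ`, `p = 5`; S given the Galois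
form).** The determinant is read on ANY elliptic `W/ℚ` framed by the same `ρ̄`
(`det_eq_modPCyclotomicCharacter_of_isTorsionGaloisRep_holds`); all framings of `E'[5]` are
conjugate (`IsTorsionGaloisRep.exists_conj_eq`) and absolute irreducibility is conjugation-invariant. -/
theorem modPImageAbsIrreducibleOverCyclotomic_five_of_isAbsIrreducibleOverSqrt
    (W : WeierstrassCurve ℚ) [W.IsElliptic] (E' : WeierstrassCurve ℚ)
    (ρ : ModPGaloisRep ℚ (ZMod 5) 2) (hρW : W.IsTorsionGaloisRep 5 ρ)
    (hρE' : E'.IsTorsionGaloisRep 5 ρ) (h : ρ.IsAbsIrreducibleOverSqrt 5) :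
    ModPImageAbsIrreducibleOverCyclotomic E' 5 := by
  sorry

/-- **D1 (integral model; PROVED).** Every elliptic `W/ℚ` is `C • (E ⊗ ℚ)` for an integral model
`E / 𝓞 ℚ` with `Δ(E) ≠ 0`, and every framing of `W[n]` frames `(E ⊗ ℚ)[n]`
(`hasGlobalMinimalModel_rat_holds` + Mathlib's `integralModel`/`baseChange_integralModel_eq`,
`IsGloballyMinimal.Δ_ne_zero`, `MatarNekovar2019.isTorsionGaloisRep_smul`). -/
theorem exists_integralModel (W : WeierstrassCurve ℚ) [W.IsElliptic] :
    ∃ (E : WeierstrassCurve (𝓞 ℚ)) (C : VariableChange ℚ),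
      C • E.baseChange ℚ = W ∧ E.Δ ≠ 0 ∧
      ∀ (n : ℕ) [Fact n.Prime] (ρ : ModPGaloisRep ℚ (ZMod n) 2),
        W.IsTorsionGaloisRep n ρ → (E.baseChange ℚ).IsTorsionGaloisRep n ρ := by
  obtain ⟨C, hC⟩ := hasGlobalMinimalModel_rat_holds W
  haveI := hC
  refine ⟨(C • W).integralModel (𝓞 ℚ), C⁻¹, ?_, IsGloballyMinimal.Δ_ne_zero (C • W),
    fun n _ ρ hρ ↦ ?_⟩
  · rw [baseChange_integralModel_eq (𝓞 ℚ) (C • W), inv_smul_smul]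
  · rw [baseChange_integralModel_eq (𝓞 ℚ) (C • W)]
    exact MatarNekovar2019.isTorsionGaloisRep_smul W C hρ

/-- **D2′ (residual Hilbert-modularity of a MODULAR curve's `5`-torsion; S/M, all inputs proved).**
Template: the proof of `WeierstrassCurve.IsTorsionGaloisRep.isHilbertModular`
(`HilbertResidualModularity`) with `π` taken from `exists_hasWeightZero_satake_of_isNewformOf`
(Gelbart's dictionary, PROVED; `O = ℤ`, `t = a_v(W')`, `s = q_v`), the Satake identity turned
into `HasHeckePolynomialAt` by its definition (`satakePolynomial_pair_eq_sq_sub`), and on the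
Galois side `IsTorsionGaloisRep.isUnramifiedAt_of_hasGoodReductionAt`,
`IsTorsionGaloisRep.charpoly_eq_of_isArithFrobAt` (+ `trace_/det_…_holds`) at the cofinitely many
good `v ∤ 5 N` (`eventually_hasGoodReductionAt`). -/
theorem isHilbertModular_of_isModular_curve (W' : WeierstrassCurve ℚ) [W'.IsElliptic]
    [NeZero (W'.conductorNorm ℤ)] (hW' : BCDT.IsModular W') (ρ : ModPGaloisRep ℚ (ZMod 5) 2)
    (hρ : W'.IsTorsionGaloisRep 5 ρ) : ρ.IsHilbertModular := by
  sorry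

/-- **D4a (weight-zero `π` of `GL₂(𝔸_ℚ)` ↦ newform on `Γ₀`; L — the one non-tree input of D4).**
A weight-zero cuspidal `π` of `GL₂(𝔸_ℚ)` with Hecke polynomials `X² - a_w(E) X + q_w` at all
`w ∤ Δ(E)` comes from a newform `g ∈ S₂(Γ₀(M))` with `a_q(g) = a_q(E ⊗ ℚ)` off `M · R`:
(arch) central character trivial (forced by the constant terms `q_w` at all `w ∤ Δ`) + the
weight-zero infinitesimal character leave `π_∞ = D₂` (Gelbart Remark 2.5.5 read backwards, as the
tree does in weight one: `GL2WeightVectors`, `NewformAdelisationDescentHolomorphy`); (fin) new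
vector = the tree's PROVED `CuspidalAutomorphicRepData.exists_gammaOneFiniteLevel_fixed`
(`GL2NewvectorExistence`, Casselman 1973 Thm. 1); Atkin–Lehner to a newform
(`exists_isNewform1_of_mem_newSubspace1`); `a_q(g) = q^{1/2} Σ α = a_q(E)` by strong multiplicity
one at the unramified places.  Port of `IsOfWeightOne.exists_isNewform1_of_exists_fixed` to weight 2. -/
theorem exists_isNewform0_of_isAutomorphicOfWeightZero_rat (E : WeierstrassCurve (𝓞 ℚ))
    (hΔ : E.Δ ≠ 0) (hE : IsAutomorphicOfWeightZero E) :
    ∃ (M : ℕ) (_ : NeZero M) (g : CuspForm (CongruenceSubgroup.Gamma0 M) 2), IsNewform0 g ∧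
      ∃ (R : ℕ) (_ : NeZero R), ∀ q : ℕ, q.Prime → ¬ q ∣ M * R →
        cuspCoeff g q = ((E.baseChange ℚ).LFunction q : ℂ) := by
  sorry

/-- **D4 = D4a + Serre 1987 §4.6 last paragraph (tree: `isModular_of_isNewform0_of_cuspCoeff_eq_off_of_three_facts`
with Faltings discharged by `isIsogenous_iff_frobeniusTrace_eq_holds`; granted Eichler–Shimura and
Carayol — both already in the line's trust base via `stub_threeImpTwo`)
+ `IsModular.isModularGaloisRepTate` (PROVED) + invariance of `aₙ` under `C` (`LFunction_smul`).
PROVED modulo D4a.** -/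
theorem isModularGaloisRepTate_of_isAutomorphicOfWeightZero (hES : eichlerShimuraConstruction)
    (hC : ∀ (N : ℕ) [NeZero N], IsNewformOf.level_eq_conductorNorm (N := N))
    (E : WeierstrassCurve (𝓞 ℚ)) (W : WeierstrassCurve ℚ) [W.IsElliptic] (C : VariableChange ℚ)
    (hCW : C • E.baseChange ℚ = W) (hΔ : E.Δ ≠ 0) (hE : IsAutomorphicOfWeightZero E) :
    W.IsModularGaloisRepTate 5 := by
  haveI : NeZero (W.conductorNorm ℤ) := ⟨(conductorNorm_pos_holds W).ne'⟩
  haveI : Fact (Nat.Prime 5) := ⟨by norm_num⟩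
  haveI : (E.baseChange ℚ).IsElliptic := by
    rw [WeierstrassCurve.isElliptic_iff, WeierstrassCurve.baseChange, WeierstrassCurve.map_Δ,
      isUnit_iff_ne_zero]
    exact (map_ne_zero_iff _ (IsFractionRing.injective (𝓞 ℚ) ℚ)).2 hΔ
  obtain ⟨M, _, g, hg, R, _, h⟩ := exists_isNewform0_of_isAutomorphicOfWeightZero_rat E hΔ hE
  have hLW : W.LFunction = (E.baseChange ℚ).LFunction := by
    rw [← hCW, WeierstrassCurve.LFunction_smul]
  have h' : ∀ q : ℕ, q.Prime → ¬ q ∣ M * R → cuspCoeff g q = (W.LFunction q : ℂ) := by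
    intro q hq hqMR
    rw [hLW]
    exact h q hq hqMR
  exact (isModular_of_isNewform0_of_cuspCoeff_eq_off_of_three_facts hES
    isIsogenous_iff_frobeniusTrace_eq_holds hC W hg h').isModularGaloisRepTate 5

/-- **Plan A, CONGRUENCE form (what `isModular_freyCurve_of_stubs` actually feeds: `E[5] ≅ E′[5]`
with `E′` a modular CURVE) — kernel-checked modulo A1, D2′, D4a (D1, D4 proved), trust base
{`FLS2015_theorem2`, ES, Carayol}; `25 ∤ N` unused.** -/
theorem liftFive_congruence_of_FLS2015_theorem2 (hFLS : FLS2015_theorem2)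
    (hES : eichlerShimuraConstruction)
    (hC : ∀ (N : ℕ) [NeZero N], IsNewformOf.level_eq_conductorNorm (N := N))
    (W : WeierstrassCurve ℚ) [W.IsElliptic] (W' : WeierstrassCurve ℚ) [W'.IsElliptic]
    [NeZero (W'.conductorNorm ℤ)] (ρ : ModPGaloisRep ℚ (ZMod 5) 2)
    (hρ : W.IsTorsionGaloisRep 5 ρ) (hρW' : W'.IsTorsionGaloisRep 5 ρ)
    (hirr : ρ.IsAbsIrreducibleOverSqrt 5) (hW' : BCDT.IsModular W') :
    W.IsModularGaloisRepTate 5 := by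
  haveI : Fact (Nat.Prime 5) := ⟨by norm_num⟩
  obtain ⟨E, C, hCW, hΔ, htors⟩ := exists_integralModel W
  have hρE : (E.baseChange ℚ).IsTorsionGaloisRep 5 ρ := htors 5 ρ hρ
  have himg : ModPImageAbsIrreducibleOverCyclotomic (E.baseChange ℚ) 5 :=
    modPImageAbsIrreducibleOverCyclotomic_five_of_isAbsIrreducibleOverSqrt W (E.baseChange ℚ) ρ hρ
      hρE hirr
  have hmod₀ : ρ.IsHilbertModular := isHilbertModular_of_isModular_curve W' hW' ρ hρW'
  exact isModularGaloisRepTate_of_isAutomorphicOfWeightZero hES hC E W C hCW hΔ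
    (hFLS.of_exists ℚ E hΔ 5 (by decide) ⟨ρ, hρE, hmod₀⟩ himg)

/-- **D2 (weight-two realisation of an abstractly modular `ρ̄`; L — needed ONLY for the stub AS
TYPED, i.e. with `ρ.IsModular` = "some newform of some weight `w ≥ 1`").**  Refined Serre
(`diamond1995_refinedSerre`/Edixhoven, named facts in the tree) puts `ρ̄` in weight `k(ρ̄) ∈ {2, 6}`
prime-to-`5` level; `k = 6 = p + 1` ↦ weight `2`, level `5N` (Serre 1987 §3 / Ash–Stevens 1986
Thm. 3.5; cf. the tree's converse `serreWeight_eq_two_or_eq_add_one_of_weightTwo_newform_dvd_level`);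
then Gelbart's dictionary as in D2′.  Killed by the lead's CONGRUENCE reshape (recommended). -/
def WeightTwoRealisationFive : Prop :=
  ∀ ρ : ModPGaloisRep ℚ (ZMod 5) 2, FramedRep.IsAbsolutelyIrreducible ρ → ρ.IsModular →
    ρ.IsHilbertModular

/-- **Plan A for the stub AS TYPED** (kernel-checked modulo A1, D4a, and the weight-two
realisation D2). -/
theorem stub_liftFive_of_planA (hFLS : FLS2015_theorem2) (hES : eichlerShimuraConstruction)
    (hC : ∀ (N : ℕ) [NeZero N], IsNewformOf.level_eq_conductorNorm (N := N))
    (hD2 : WeightTwoRealisationFive) : Sig := by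
  intro W _ ρ hρ hirr _h25 hmod
  haveI : Fact (Nat.Prime 5) := ⟨by norm_num⟩
  obtain ⟨E, C, hCW, hΔ, htors⟩ := exists_integralModel W
  have hρE : (E.baseChange ℚ).IsTorsionGaloisRep 5 ρ := htors 5 ρ hρ
  have himg : ModPImageAbsIrreducibleOverCyclotomic (E.baseChange ℚ) 5 :=
    modPImageAbsIrreducibleOverCyclotomic_five_of_isAbsIrreducibleOverSqrt W (E.baseChange ℚ) ρ hρ
      hρE hirr
  exact isModularGaloisRepTate_of_isAutomorphicOfWeightZero hES hC E W C hCW hΔ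
    (hFLS.of_exists ℚ E hΔ 5 (by decide) ⟨ρ, hρE, hD2 ρ hirr.isAbsolutelyIrreducible hmod⟩ himg)

/-! ## Plan B — bootstrap through Serre's conjecture: the tree's KW road with `hwt` DISCHARGED -/

section SerreRoad

open ValuativeRel Literature.NumberTheory.GaloisRepresentations.ModPGaloisRep
open Literature.NumberTheory.GaloisRepresentations.IsNonarchimedeanLocalField
open Literature.NumberTheory.DiophantineGeometry Literature.NumberTheory.EllipticCurves.SkinnerUrban2014
open Rat.HeightOneSpectrum

/-- Khare–Wintenberger at every prime (the road's `hKW`). -/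
def KWAll : Prop :=
  ∀ (p : ℕ) [Fact p.Prime] (k : Type) [Field k] [TopologicalSpace k] [DiscreteTopology k],
    khare_wintenberger p k

/-- The weight hypothesis of Serre's road AT THE CANONICAL LOCAL DATUM `(ℚ_v, ρ̄|Γ_{ℚ_v})`,
`v` the place above `p` — which is all the road needs once re-threaded (B1′), and which the tree
PROVES at good odd `p` (`serreWeight_eq_two_of_hasGoodReductionAt`). -/
def SerreWeightTwoCanonical : Prop :=
  ∀ (W : WeierstrassCurve ℚ) [W.IsElliptic], ∃ p₀ : ℕ, ∀ (p : ℕ) [Fact p.Prime], p₀ ≤ p →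
    ∀ ρ : ModPGaloisRep ℚ (ZMod p) 2, W.IsTorsionGaloisRep p ρ →
      ∀ (k : Type) [Field k] [TopologicalSpace k] [DiscreteTopology k] (j : ZMod p →+* k)
        (v : HeightOneSpectrum (𝓞 ℚ)) (hpv : (p : 𝓞 ℚ) ∈ v.asIdeal)
        (ι : absIntegers 𝒪[v.adicCompletion ℚ] (v.adicCompletion ℚ) ⧸
          absMaximalIdeal (v.adicCompletion ℚ) →+* k),
        serreWeight p (FramedRep.baseChange j continuous_of_discreteTopology ρ)
          { F := v.adicCompletion ℚ
            residueFieldCard_eq := residueFieldCard_adicCompletion_eq_of_natCast_mem hpv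
            irreducible_natCast :=
              irreducible_natCast_valuativeInteger_adicCompletion_of_natCast_mem hpv
            rep := FramedGaloisRep.restrictField (v.adicCompletion ℚ)
              (FramedRep.baseChange j continuous_of_discreteTopology ρ)
            rep_eq_restrictField := rfl } ι = 2

/-- **B2 (PROVED): the canonical weight hypothesis holds** — for `p > N_W + 2`, `W` has good
reduction at `v ∣ p` (`hasGoodReductionAt_of_not_dvd_conductorNorm`) and Serre's recipe gives
weight `2` there (`serreWeight_eq_two_of_hasGoodReductionAt`). -/
theorem serreWeightTwoCanonical_holds : SerreWeightTwoCanonical := by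
  intro W _
  refine ⟨W.conductorNorm ℤ + 3, fun p _ hp ρ hρ k _ _ _ j v hpv ι ↦ ?_⟩
  have hp2 : p ≠ 2 := by omega
  have hv : ((primesEquiv v : Nat.Primes) : ℕ) = p :=
    (natCast_mem_asIdeal_iff_primesEquiv_eq v Fact.out).mp hpv
  have hndvd : ¬ ((primesEquiv v : Nat.Primes) : ℕ) ∣ W.conductorNorm ℤ := by
    rw [hv]
    exact Nat.not_dvd_of_pos_of_lt (W.conductorNorm_pos_holds) (by omega)
  exact serreWeight_eq_two_of_hasGoodReductionAt W p hp2 v hpv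
    (hasGoodReductionAt_of_not_dvd_conductorNorm W v hndvd) hρ k j ι

/-- **B1′ (Serre's road at the canonical datum; M, MECHANICAL).** The tree's
`CDT_theorem_7_2_2_of_khare_wintenberger_of_serreWeight_of_conductorNatOf_of_three_facts`
(`CDTTheorem722SerreLevelProofs`; Faltings `hF` := `isIsogenous_iff_frobeniusTrace_eq_holds`) asks `hwt`
at EVERY `LocalRestrictionAt p` datum only because `forall_isTorsionGaloisRep_exists_isNewform1_of_khare_wintenberger`
(`CDTTheorem722SerreProofs`, Step 2) applies `khare_wintenberger` at `nonempty_localRestrictionAt p ρ'`;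
re-thread those four theorems with the canonical datum `(ℚ_v, ρ̄'|Γ_{ℚ_v})` (as
`GeneralizedFermatTwoPowerCoefficientSerreWeightProofs` already does) — no new mathematics. -/
theorem CDT_theorem_7_2_2_of_khare_wintenberger_canonical (hKW : KWAll)
    (hwt : SerreWeightTwoCanonical)
    (hN : ∀ (W : WeierstrassCurve ℚ) (ℓ : ℕ) [Fact ℓ.Prime],
      W.conductorNatOf_geomPoints_eq_conductorNorm_of_isElliptic ℓ)
    (hES : eichlerShimuraConstruction)
    (hC : ∀ (N : ℕ) [NeZero N], IsNewformOf.level_eq_conductorNorm (N := N)) :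
    CDT_theorem_7_2_2 := by
  sorry

/-- **Plan B closer (kernel-checked modulo B1′): trust base {`khare_wintenberger`, the `ℓ`-adic
conductor fact `hN`, ES, Carayol}; `hwt` GONE; `25 ∤ N` and `ρ.IsModular` unused (Serre's road
re-proves residual modularity for large `p`).** -/
theorem stub_liftFive_of_KW (hKW : KWAll)
    (hN : ∀ (W : WeierstrassCurve ℚ) (ℓ : ℕ) [Fact ℓ.Prime],
      W.conductorNatOf_geomPoints_eq_conductorNorm_of_isElliptic ℓ)
    (hES : eichlerShimuraConstruction)
    (hC : ∀ (N : ℕ) [NeZero N], IsNewformOf.level_eq_conductorNorm (N := N)) : Sig :=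
  fun W _ ρ hρ hirr _ hmod ↦
    lift_of_CDT_theorem_7_2_2
      (CDT_theorem_7_2_2_of_khare_wintenberger_canonical hKW serreWeightTwoCanonical_holds hN hES hC)
      W ρ hρ hirr hmod

end SerreRoad

/-! ## Plan 0 — the line's own closer (for reference): `CDT_theorem_7_2_2` ⇒ stub -/

theorem stub_liftFive_of_CDT722 (h : CDT_theorem_7_2_2) : Sig :=
  fun W _ ρ hρ hirr _ hmod ↦ lift_of_CDT_theorem_7_2_2 h W ρ hρ hirr hmod

end Summit.ABC.ABC.Cruxes.FreyModularity.StubIdeas.LiftFive2g2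

end
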